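import Summits.ValiantsHypothesis.ValiantsHypothesis.Theorems.GeneratorObstructionsPerGenDegreeSuperQPFaceLayers

/-!
# Route GeneratorObstructions — K1 `PerGenDegreeSuperQP` (stmt-ValiantsHypothesis-11654),
# line `per-side-atoms`: the SANDWICH NO-GO FORMAT for `stub_atomLate`
# (late atoms need super-quasi-polynomially late HOLES of the occurrence monoid inside every
# early-generated over-monoid — e.g. inside the lifted orbit monoid of the permanent)

Support file of the line (companions `…AtomsGenerate` — atoms generate, late atoms ⟺ late
generation —, `…FaceLayers` / `…JumpAtoms` — face layers and first fattenings start with an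
atom, `stub_atomLate` ⇐ a late first fattening). Those files give SUFFICIENT conditions for the
registered stub; this file gives the matching NECESSARY condition, i.e. the format in which the
stub is refuted.

**Sandwich principle** (pure monoid combinatorics, `exists_splitting_of_sandwich`). Let `G` be any
set of weights of degree `≤ a` (`-|g| ≤ a`) and `Occ` any property of weights such that every
element of the additive monoid `⟨G⟩` of degree `≥ p > 0` has `Occ` ("`⟨G⟩` agrees with `Occ`
beyond the threshold `p`"). Then every `χ ∈ ⟨G⟩` of degree `≥ 2p + a` splits as `χ = χ₁ + χ₂`
with `χᵢ ≠ 0` and `Occ χᵢ`: write `χ` as a sum of elements of `G` and cut the sum greedily at the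
first partial sum of degree `≥ p` (`exists_le_multiset_size_window`); that part has degree in
`[p, p + a)`, the rest has degree `> p`.

Consequences for the occurrence monoid `S(f) = {χ : HWV_χ(ℂ[Δ_n[f]]) ≠ ⊥}` of ANY polynomial
(`Occ = occurs`):

* `neg_size_lt_of_atom_of_sandwich` — if `S(f) ⊆ ⟨G⟩` for a set `G` of weights of degree `≤ a`
  and `⟨G⟩ ∩ {degree ≥ p} ⊆ S(f)`, then every ATOM of `S(f)` has degree `< 2p + a`; hence
  (`mem_closure_early_of_sandwich`) `S(f)` is generated in degree `< 2p + a`. (Up to the constant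
  this is EQUIVALENT to early generation — take `G = S(f)_{≤ a}` — but the hypotheses are checked
  by different means: `G` may consist of NON-occurring weights.)
* `exists_lateHole_of_lateAtom` — contrapositive at one `f`: an atom of degree `≥ 2p + a` forces,
  for EVERY set `G` of weights of degree `≤ a` with `S(f) ⊆ ⟨G⟩`, a HOLE `ψ ∈ ⟨G⟩ ∖ S(f)` of
  degree `≥ p`.
* `stub_atomLate_false_of_eventualSandwich` — **the no-go format for the registered stub**: if
  for some `c` and all large `m` the occurrence monoid `S(per_m)` is sandwiched,
  `S(per_m) ⊆ ⟨G_m⟩` and `⟨G_m⟩ ∩ {-|χ| ≥ m·2^((log₂ m + c)^c)} ⊆ S(per_m)` with `G_m` of degrees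
  `-|g| ≤ m·2^((log₂ m + c)^c)`, then `stub_atomLate` is FALSE (stated as the negation of the
  registered signature verbatim; the stub at `c + 2` is contradicted, `3·2^(x^c) ≤ 2^((x+2)^(c+2))`).
* `lateHoles_of_stub_atomLate` — equivalently, what the stub REQUIRES: for every `c` and
  infinitely many `m`, EVERY quasi-polynomially generated over-monoid of `S(per_m)` has a hole of
  degree `≥ 2^((log₂ m + c)^c)` (a weight of the over-monoid at which no highest-weight vector of
  `ℂ[Δ_m[per_m]]` exists).

Intended instance (informal; NOT used in the proofs — see the evidence memos of the hands
val-width-11654-p1 and leafhand-val-generatorobstructi-4 g0 on the item). Along the closed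
`SL_{m²}`-orbit of the polystable `per_m`, occurrence in the CLOSURE implies occurrence in the
ORBIT: `mult_χ ℂ[Δ(per_m)] ≤ dim {λ(χ)}^{H_per}` (tree:
`IK2020.orbitMultiplicity_toMatIdx_le_weylInvariantDim`, BLMW 2011 §4–5), so `S(per_m)` lies in
the lifted orbit monoid `S°↑ = {χ : V_{λ(χ)}^{H_per} ≠ 0}`, `H_per = T^{2m-2}·((S_m × S_m) ⋊ 2)`,
all of whose atoms have polynomial level (orbit-monoid memo of g0, Thm 2.6 there; on paper).
Taking `G_m` = the atoms of `S°↑`, the sandwich hypothesis becomes a quasi-polynomial EXTENSION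
THRESHOLD: every `H_per`-invariant orbit type of degree `≥ qp(m)` extends from the orbit to the
closure (Bürgisser–Ikenmeyer 2017 Prop. 3.9 gives `ℂ[GL·per_m] = ℂ[Δ(per_m)]_Φ`, i.e. extension
after multiplying by a power of the fundamental invariant, with no bound). So `stub_atomLate`
(`c ≥ 2`) holds iff such thresholds fail super-quasi-polynomially for infinitely many `m`: late
atoms are late HOLES of the closure monoid inside the orbit monoid — the two-sided form of the
one-sided reductions of `…JumpAtoms` (`stub ⇐ late first fattening`). Neither a quasi-polynomial
extension threshold nor a super-quasi-polynomial hole is in print for any explicit orbit closure.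

Honest framing: an elementary no-go FORMAT and its contrapositive; no hypothesis of it is
discharged here; `stub_atomLate` (for `c ≥ 2`), K1 and `GenFlipThesis` remain OPEN; nothing here
bears on VP versus VNP. References: [BurgisserIkenmeyer2017] Prop. 3.9; [BurgisserEtAl2011]
§4.1, §5.5; [DerksenMakam2020] Lemma 1.3 (surjections preserve generating degrees) as background
only. [folklore]
-/

set_option linter.dupNamespace false

namespace Summit.ValiantsHypothesis.ValiantsHypothesis.Theorems.GeneratorObstructions.PerGenDegreeSuperQP

open MvPolynomial
open Literature.NumberTheory.DiophantineGeometry Literature.Computability.AlgebraicComplexity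
  Literature.Computability.Complexity

/-! ### 1. The sandwich principle (monoid combinatorics) -/

section Sandwich

variable {σ : Type*} [Fintype σ]

/-- The size of a multiset sum of weights is the sum of the sizes. [folklore] -/
theorem size_multiset_sum (l : Multiset (Weight σ)) :
    l.sum.size = (l.map Weight.size).sum := by
  induction l using Multiset.induction_on with
  | empty => simp [Weight.size]
  | cons a s ih => rw [Multiset.sum_cons, size_add_eq, ih, Multiset.map_cons, Multiset.sum_cons]

/-- **Greedy window.** If every element of a multiset of weights has degree `-|g| ≤ a` (`a > 0`),
then every threshold `q` with `0 ≤ q ≤ -|Σ l|` is bracketed by a sub-multisum: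
`q ≤ -|Σ l₁| < q + a` for some `l₁ ≤ l` (peel summands one at a time). [folklore] -/
theorem exists_le_multiset_size_window (l : Multiset (Weight σ)) {a : ℤ} (ha : 0 < a)
    (hl : ∀ g ∈ l, -(Weight.size g) ≤ a) {q : ℤ} (hq0 : 0 ≤ q) (hq : q ≤ -(Weight.size l.sum)) :
    ∃ l₁ ≤ l, q ≤ -(Weight.size l₁.sum) ∧ -(Weight.size l₁.sum) < q + a := by
  induction l using Multiset.induction_on with
  | empty =>
    refine ⟨0, le_rfl, ?_, ?_⟩
    · simpa [Weight.size] using hq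
    · have h0 : q ≤ 0 := by simpa [Weight.size] using hq
      have : q = 0 := le_antisymm h0 hq0
      simp [Weight.size, this, ha]
  | cons g s ih =>
    by_cases h : q ≤ -(Weight.size s.sum)
    · obtain ⟨l₁, hl₁, h1, h2⟩ := ih (fun x hx => hl x (Multiset.mem_cons_of_mem hx)) h
      exact ⟨l₁, hl₁.trans (Multiset.le_cons_self s g), h1, h2⟩
    · refine ⟨g ::ₘ s, le_rfl, hq, ?_⟩
      have hg := hl g (Multiset.mem_cons_self g s)
      rw [Multiset.sum_cons, size_add_eq]
      push Not at h
      linarith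

/-- **Sandwich principle.** Let `G` be a set of weights of degree `-|g| ≤ a` (`a > 0`) and `Occ`
a property holding at every element of the additive monoid `⟨G⟩` of degree `≥ p` (`p > 0`).
Then every `χ ∈ ⟨G⟩` of degree `-|χ| ≥ 2p + a` splits as `χ = χ₁ + χ₂` with `χ₁, χ₂ ≠ 0` both
satisfying `Occ`: cut a `G`-sum for `χ` at the first partial sum of degree `≥ p`
(`exists_le_multiset_size_window`); it has degree `< p + a`, so the remainder has degree `> p`.
[folklore] -/
theorem exists_splitting_of_sandwich (Occ : Weight σ → Prop) (G : Set (Weight σ)) {p a : ℤ}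
    (hp : 0 < p) (ha : 0 < a) (hGa : ∀ g ∈ G, -(Weight.size g) ≤ a)
    (hT : ∀ ψ ∈ AddSubmonoid.closure G, p ≤ -(Weight.size ψ) → Occ ψ)
    {χ : Weight σ} (hχG : χ ∈ AddSubmonoid.closure G) (hχ : 2 * p + a ≤ -(Weight.size χ)) :
    ∃ χ₁ χ₂ : Weight σ, χ₁ + χ₂ = χ ∧ χ₁ ≠ 0 ∧ χ₂ ≠ 0 ∧ Occ χ₁ ∧ Occ χ₂ := by
  classical
  obtain ⟨l, hlG, hls⟩ := AddSubmonoid.exists_multiset_of_mem_closure hχG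
  obtain ⟨l₁, hl₁, h1, h2⟩ := exists_le_multiset_size_window l ha
    (fun g hg => hGa g (hlG g hg)) hp.le (by rw [hls]; linarith)
  obtain ⟨l₂, rfl⟩ := Multiset.le_iff_exists_add.mp hl₁
  have hsum : l₁.sum + l₂.sum = χ := by rw [← Multiset.sum_add, hls]
  have hsize : Weight.size l₁.sum + Weight.size l₂.sum = Weight.size χ := by
    rw [← size_add_eq, hsum]
  have hmem1 : l₁.sum ∈ AddSubmonoid.closure G :=
    AddSubmonoid.multiset_sum_mem _ _ fun x hx =>
      AddSubmonoid.subset_closure (hlG x (Multiset.mem_add.mpr (Or.inl hx)))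
  have hmem2 : l₂.sum ∈ AddSubmonoid.closure G :=
    AddSubmonoid.multiset_sum_mem _ _ fun x hx =>
      AddSubmonoid.subset_closure (hlG x (Multiset.mem_add.mpr (Or.inr hx)))
  have hp2 : p ≤ -(Weight.size l₂.sum) := by linarith
  refine ⟨l₁.sum, l₂.sum, hsum, ?_, ?_, hT _ hmem1 h1, hT _ hmem2 hp2⟩
  · intro h0
    rw [h0] at h1
    simp [Weight.size] at h1
    linarith
  · intro h0
    rw [h0] at hp2
    simp [Weight.size] at hp2
    linarith

end Sandwich

/-! ### 2. Occurrence monoids: atoms are early under a sandwich; late atoms force late holes -/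

section Occurrence

variable {σ : Type*} [Fintype σ] [LinearOrder σ]

/-- **Atoms of a sandwiched occurrence monoid are early.** If the occurrence monoid
`S(f) = {χ : HWV_χ(ℂ[Δ_n[f]]) ≠ ⊥}` is contained in the monoid `⟨G⟩` generated by a set `G` of
weights of degree `-|g| ≤ a`, and every element of `⟨G⟩` of degree `≥ p` occurs (`p, a > 0`),
then every occurring ATOM `χ` (no splitting into two nonzero occurring weights) has
`-|χ| < 2p + a`. [folklore] -/
theorem neg_size_lt_of_atom_of_sandwich (f : MvPolynomial σ ℂ) (n : ℕ) (G : Set (Weight σ))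
    {p a : ℤ} (hp : 0 < p) (ha : 0 < a) (hGa : ∀ g ∈ G, -(Weight.size g) ≤ a)
    (hS : ∀ χ : Weight σ, highestWeightSpace (orbitCoordRep f n) χ ≠ ⊥ → χ ∈ AddSubmonoid.closure G)
    (hT : ∀ ψ ∈ AddSubmonoid.closure G, p ≤ -(Weight.size ψ) →
      highestWeightSpace (orbitCoordRep f n) ψ ≠ ⊥)
    {χ : Weight σ} (hχ : highestWeightSpace (orbitCoordRep f n) χ ≠ ⊥)
    (hatom : ∀ χ₁ χ₂ : Weight σ, χ₁ + χ₂ = χ → χ₁ ≠ 0 → χ₂ ≠ 0 →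
      highestWeightSpace (orbitCoordRep f n) χ₁ = ⊥ ∨ highestWeightSpace (orbitCoordRep f n) χ₂ = ⊥) :
    -(Weight.size χ) < 2 * p + a := by
  by_contra h
  push Not at h
  obtain ⟨χ₁, χ₂, hsum, h1, h2, ho1, ho2⟩ := exists_splitting_of_sandwich
    (fun ψ => highestWeightSpace (orbitCoordRep f n) ψ ≠ ⊥) G hp ha hGa hT (hS χ hχ) h
  rcases hatom χ₁ χ₂ hsum h1 h2 with h' | h'
  · exact ho1 h'
  · exact ho2 h'

/-- **A sandwiched occurrence monoid is generated early**: under the hypotheses of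
`neg_size_lt_of_atom_of_sandwich` (and `n ≠ 0`), every occurring weight is a sum of occurring
weights of degree `-|ψ| < 2p + a` — atoms generate (`exists_multiset_atoms_sum_eq`) and atoms are
early. So, up to the constant, the sandwich hypothesis is equivalent to early generation of
`S(f)` (`…AtomsGenerate.exists_late_atom_iff_not_generated`); its point is that `G` need not
consist of occurring weights. [folklore] -/
theorem mem_closure_early_of_sandwich (f : MvPolynomial σ ℂ) {n : ℕ} (hn : n ≠ 0)
    (G : Set (Weight σ)) {p a : ℤ} (hp : 0 < p) (ha : 0 < a) (hGa : ∀ g ∈ G, -(Weight.size g) ≤ a)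
    (hS : ∀ χ : Weight σ, highestWeightSpace (orbitCoordRep f n) χ ≠ ⊥ → χ ∈ AddSubmonoid.closure G)
    (hT : ∀ ψ ∈ AddSubmonoid.closure G, p ≤ -(Weight.size ψ) →
      highestWeightSpace (orbitCoordRep f n) ψ ≠ ⊥)
    {χ : Weight σ} (hχ : highestWeightSpace (orbitCoordRep f n) χ ≠ ⊥) :
    χ ∈ AddSubmonoid.closure {ψ : Weight σ |
      highestWeightSpace (orbitCoordRep f n) ψ ≠ ⊥ ∧ -(Weight.size ψ) < 2 * p + a} := by
  obtain ⟨l, hl, hls⟩ := exists_multiset_atoms_sum_eq f hn hχ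
  rw [← hls]
  refine AddSubmonoid.multiset_sum_mem _ l fun b hb => AddSubmonoid.subset_closure ?_
  obtain ⟨hb1, -, hb3⟩ := hl b hb
  exact ⟨hb1, neg_size_lt_of_atom_of_sandwich f n G hp ha hGa hS hT hb1 hb3⟩

/-- **Late atoms force late holes.** If `S(f) ⊆ ⟨G⟩` for a set `G` of weights of degree
`-|g| ≤ a` (`p, a > 0`) and `S(f)` has an occurring ATOM of degree `-|χ| ≥ 2p + a`, then the
over-monoid `⟨G⟩` has a HOLE of degree `≥ p`: a weight `ψ ∈ ⟨G⟩` with `-|ψ| ≥ p` at which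
`ℂ[Δ_n[f]]` has no highest-weight vector. [folklore] -/
theorem exists_lateHole_of_lateAtom (f : MvPolynomial σ ℂ) (n : ℕ) (G : Set (Weight σ))
    {p a : ℤ} (hp : 0 < p) (ha : 0 < a) (hGa : ∀ g ∈ G, -(Weight.size g) ≤ a)
    (hS : ∀ χ : Weight σ, highestWeightSpace (orbitCoordRep f n) χ ≠ ⊥ → χ ∈ AddSubmonoid.closure G)
    {χ : Weight σ} (hχ : highestWeightSpace (orbitCoordRep f n) χ ≠ ⊥)
    (hatom : ∀ χ₁ χ₂ : Weight σ, χ₁ + χ₂ = χ → χ₁ ≠ 0 → χ₂ ≠ 0 →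
      highestWeightSpace (orbitCoordRep f n) χ₁ = ⊥ ∨ highestWeightSpace (orbitCoordRep f n) χ₂ = ⊥)
    (hlate : 2 * p + a ≤ -(Weight.size χ)) :
    ∃ ψ ∈ AddSubmonoid.closure G, p ≤ -(Weight.size ψ) ∧
      highestWeightSpace (orbitCoordRep f n) ψ = ⊥ := by
  by_contra h
  push Not at h
  exact absurd hlate (not_le.mpr (neg_size_lt_of_atom_of_sandwich f n G hp ha hGa hS h hχ hatom))

end Occurrence

/-! ### 3. The permanent: the no-go format for `stub_atomLate` and its contrapositive -/

section Permanent

/-- Threshold arithmetic: `3 · 2^(x^c) ≤ 2^((x+2)^(c+2))` (so the stub at `c + 2` beats three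
times the bound at `c`). [folklore] -/
theorem three_mul_two_pow_le_two_pow_shift (x c : ℕ) :
    3 * 2 ^ (x ^ c) ≤ 2 ^ ((x + 2) ^ (c + 2)) := by
  have h : x ^ c + 2 ≤ (x + 2) ^ (c + 2) := by
    rcases Nat.eq_zero_or_pos c with rfl | hc
    · have h4 : 2 ^ 2 ≤ (x + 2) ^ 2 := Nat.pow_le_pow_left (by omega) 2
      simpa using le_trans (by norm_num) h4
    · have h1 : x ^ c + 1 ≤ (x + 2) ^ c := by
        have hx := pow_add_pow_le (show 0 ≤ x by omega) (show (0 : ℕ) ≤ 2 by omega)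
          (Nat.pos_iff_ne_zero.mp hc)
        have h2 : 1 ≤ 2 ^ c := Nat.one_le_two_pow
        omega
      have h4 : 4 ≤ (x + 2) ^ 2 := by
        have := Nat.pow_le_pow_left (show 2 ≤ x + 2 by omega) 2
        simpa using this
      calc x ^ c + 2 ≤ (x ^ c + 1) * 4 := by omega
        _ ≤ (x + 2) ^ c * (x + 2) ^ 2 := Nat.mul_le_mul h1 h4
        _ = (x + 2) ^ (c + 2) := by rw [← pow_add]
  calc 3 * 2 ^ (x ^ c) ≤ 4 * 2 ^ (x ^ c) := by omega
    _ = 2 ^ (x ^ c + 2) := by rw [pow_add]; ring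
    _ ≤ 2 ^ ((x + 2) ^ (c + 2)) := Nat.pow_le_pow_right (by norm_num) h

variable {m : ℕ}

/-- **Atoms of `S(per_m)` are early under a sandwich** (the permanent instance of
`neg_size_lt_of_atom_of_sandwich`, thresholds written as multiples of `m` = `m`·degree): if
`S(per_m) ⊆ ⟨G⟩` with `G` of degrees `-|g| ≤ a` and `⟨G⟩ ∩ {-|ψ| ≥ p} ⊆ S(per_m)` (`p, a > 0`),
then every occurring atom `χ` of `ℂ[Δ_m[per_m]]` has `-|χ| < 2p + a`. [folklore] -/
theorem per_neg_size_lt_of_atom_of_sandwich (G : Set (Weight (MatIdx m))) {p a : ℤ}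
    (hp : 0 < p) (ha : 0 < a) (hGa : ∀ g ∈ G, -(Weight.size g) ≤ a)
    (hS : ∀ χ : Weight (MatIdx m),
      highestWeightSpace (orbitCoordRep (MvPolynomial.rename toLex (perPoly (Fin m) ℂ)) m) χ ≠ ⊥ →
        χ ∈ AddSubmonoid.closure G)
    (hT : ∀ ψ ∈ AddSubmonoid.closure G, p ≤ -(Weight.size ψ) →
      highestWeightSpace (orbitCoordRep (MvPolynomial.rename toLex (perPoly (Fin m) ℂ)) m) ψ ≠ ⊥)
    {χ : Weight (MatIdx m)}
    (hχ : highestWeightSpace (orbitCoordRep (MvPolynomial.rename toLex (perPoly (Fin m) ℂ)) m) χ ≠ ⊥)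
    (hatom : ∀ χ₁ χ₂ : Weight (MatIdx m), χ₁ + χ₂ = χ → χ₁ ≠ 0 → χ₂ ≠ 0 →
      highestWeightSpace (orbitCoordRep (MvPolynomial.rename toLex (perPoly (Fin m) ℂ)) m) χ₁ = ⊥ ∨
        highestWeightSpace (orbitCoordRep (MvPolynomial.rename toLex (perPoly (Fin m) ℂ)) m) χ₂ = ⊥) :
    -(Weight.size χ) < 2 * p + a :=
  neg_size_lt_of_atom_of_sandwich _ m G hp ha hGa hS hT hχ hatom

/-- **The sandwich no-go format for `stub_atomLate`.** Suppose that for some `c` and all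
`m ≥ max(m₀, 1)` the occurrence monoid `S(per_m)` of `ℂ[Δ_m[per_m]]` is SANDWICHED at the
quasi-polynomial threshold `q(m) = m · 2^((log₂ m + c)^c)`: there is a set `G_m` of weights of
degree `-|g| ≤ q(m)` with `S(per_m) ⊆ ⟨G_m⟩` and every `χ ∈ ⟨G_m⟩` with `-|χ| ≥ q(m)` occurring.
Then the registered `stub_atomLate` is FALSE (its negation, with the registered signature
verbatim): every atom has `-|χ| < 3 q(m) ≤ m · 2^((log₂ m + c + 2)^(c+2))`, contradicting the
stub at `(c + 2, m₀)`. Intended `G_m`: the (polynomial-level) atoms of the lifted orbit monoid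
`{χ : V_{λ(χ)}^{H_per} ≠ 0}` — then the second clause is a quasi-polynomial extension threshold
from the orbit to the closure (module docstring). [folklore] -/
theorem stub_atomLate_false_of_eventualSandwich
    (H : ∃ c m₀ : ℕ, ∀ m : ℕ, m₀ ≤ m → 1 ≤ m → ∃ G : Set (Weight (MatIdx m)),
      (∀ g ∈ G, -(Weight.size g) ≤ (m : ℤ) * 2 ^ ((Nat.log 2 m + c) ^ c)) ∧
      (∀ χ : Weight (MatIdx m),
        highestWeightSpace (orbitCoordRep (MvPolynomial.rename toLex (perPoly (Fin m) ℂ)) m) χ ≠ ⊥ →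
          χ ∈ AddSubmonoid.closure G) ∧
      (∀ χ ∈ AddSubmonoid.closure G, (m : ℤ) * 2 ^ ((Nat.log 2 m + c) ^ c) ≤ -(Weight.size χ) →
        highestWeightSpace (orbitCoordRep (MvPolynomial.rename toLex (perPoly (Fin m) ℂ)) m) χ ≠ ⊥)) :
    ¬ (∀ c m₀ : ℕ, ∃ m : ℕ, m₀ ≤ m ∧ 1 ≤ m ∧ ∃ χ : Weight (MatIdx m),
      highestWeightSpace (orbitCoordRep (MvPolynomial.rename toLex (perPoly (Fin m) ℂ)) m) χ ≠ ⊥ ∧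
      (∀ χ₁ χ₂ : Weight (MatIdx m), χ₁ + χ₂ = χ → χ₁ ≠ 0 → χ₂ ≠ 0 →
          highestWeightSpace (orbitCoordRep (MvPolynomial.rename toLex (perPoly (Fin m) ℂ)) m) χ₁ = ⊥ ∨ highestWeightSpace (orbitCoordRep (MvPolynomial.rename toLex (perPoly (Fin m) ℂ)) m) χ₂ = ⊥) ∧
      (m : ℤ) * 2 ^ ((Nat.log 2 m + c) ^ c) < -(Weight.size χ)) := by
  obtain ⟨c, m₀, hH⟩ := H
  intro hstub
  obtain ⟨m, hm₀, hm1, χ, hχ, hatom, hdeg⟩ := hstub (c + 2) m₀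
  obtain ⟨G, hGa, hS, hT⟩ := hH m hm₀ hm1
  have hm : (0 : ℤ) < m := by exact_mod_cast hm1
  have hq : (0 : ℤ) < (m : ℤ) * 2 ^ ((Nat.log 2 m + c) ^ c) := mul_pos hm (pow_pos (by norm_num) _)
  have hlt := per_neg_size_lt_of_atom_of_sandwich G hq hq hGa hS hT hχ hatom
  have key : (3 : ℤ) * 2 ^ ((Nat.log 2 m + c) ^ c) ≤ 2 ^ ((Nat.log 2 m + (c + 2)) ^ (c + 2)) := by
    rw [← add_assoc]
    exact_mod_cast three_mul_two_pow_le_two_pow_shift (Nat.log 2 m + c) c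
  have key' : (m : ℤ) * (3 * 2 ^ ((Nat.log 2 m + c) ^ c)) ≤
      (m : ℤ) * 2 ^ ((Nat.log 2 m + (c + 2)) ^ (c + 2)) := mul_le_mul_of_nonneg_left key hm.le
  linarith

/-- **What `stub_atomLate` requires (contrapositive of the no-go format).** If the registered
`stub_atomLate` holds, then for every `c` and `m₀` there is `m ≥ max(m₀, 1)` such that EVERY set
`G` of weights of degree `-|g| ≤ m · 2^((log₂ m + c)^c)` whose monoid contains `S(per_m)` has a
HOLE beyond the threshold: a weight `χ ∈ ⟨G⟩` with `-|χ| ≥ m · 2^((log₂ m + c)^c)` at which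
`ℂ[Δ_m[per_m]]` has NO highest-weight vector. With `G` = the atoms of the lifted orbit monoid of
`per_m` (polynomial level, on paper): late atoms are super-quasi-polynomially late holes of the
closure monoid inside the orbit monoid, for infinitely many `m`. [folklore] -/
theorem lateHoles_of_stub_atomLate
    (hstub : ∀ c m₀ : ℕ, ∃ m : ℕ, m₀ ≤ m ∧ 1 ≤ m ∧ ∃ χ : Weight (MatIdx m),
      highestWeightSpace (orbitCoordRep (MvPolynomial.rename toLex (perPoly (Fin m) ℂ)) m) χ ≠ ⊥ ∧
      (∀ χ₁ χ₂ : Weight (MatIdx m), χ₁ + χ₂ = χ → χ₁ ≠ 0 → χ₂ ≠ 0 →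
          highestWeightSpace (orbitCoordRep (MvPolynomial.rename toLex (perPoly (Fin m) ℂ)) m) χ₁ = ⊥ ∨ highestWeightSpace (orbitCoordRep (MvPolynomial.rename toLex (perPoly (Fin m) ℂ)) m) χ₂ = ⊥) ∧
      (m : ℤ) * 2 ^ ((Nat.log 2 m + c) ^ c) < -(Weight.size χ))
    (c m₀ : ℕ) :
    ∃ m : ℕ, m₀ ≤ m ∧ 1 ≤ m ∧ ∀ G : Set (Weight (MatIdx m)),
      (∀ g ∈ G, -(Weight.size g) ≤ (m : ℤ) * 2 ^ ((Nat.log 2 m + c) ^ c)) →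
      (∀ χ : Weight (MatIdx m),
        highestWeightSpace (orbitCoordRep (MvPolynomial.rename toLex (perPoly (Fin m) ℂ)) m) χ ≠ ⊥ →
          χ ∈ AddSubmonoid.closure G) →
      ∃ χ ∈ AddSubmonoid.closure G, (m : ℤ) * 2 ^ ((Nat.log 2 m + c) ^ c) ≤ -(Weight.size χ) ∧
        highestWeightSpace (orbitCoordRep (MvPolynomial.rename toLex (perPoly (Fin m) ℂ)) m) χ = ⊥ := by
  by_contra h
  push Not at h
  exact stub_atomLate_false_of_eventualSandwich ⟨c, m₀, h⟩ hstub

end Permanent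

end Summit.ValiantsHypothesis.ValiantsHypothesis.Theorems.GeneratorObstructions.PerGenDegreeSuperQP
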